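import Summits.CriticalPhenomena.PercolationContinuityZ3.Theorems.PercNearOneGluingNoHeavyLowerTailSahiThreeCopy
import Literature.Combinatorics.Sahi2008.UnderlyingIndependents
import Summits.CriticalPhenomena.PercolationContinuityZ3.Theorems.SahiConjecture

/-!
# `NoHeavyLowerTail` (crux stmt-CriticalPhenomena-4575), Sahi programme: **THE THREE-COPY (tensor-Bernstein) EXPANSION
# OF SAHI'S `E₃` UNDER A PRODUCT MEASURE, and 3C-SAHI ⇒ `C₃` FOR EVERY FKG POSET ⇒ KAHN'S CONJECTURE 5**

Support file (Sahi cell, seat `prim-sahi-p1`, generation 53; `--supports stmt-CriticalPhenomena-4575`); companion of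
`…SahiThreeCopy` (the functionals `N_b`, `c_b = tc`, three-copy Harris, the obligation `ThreeCopySahi`).  Pure proofs plus two
bookkeeping definitions (`bern3`, `profile`); no `sorry`, standard axioms.  Typed on the census's request (CENSUS §175 / W197).

THE IDENTITY (`sahiE_three_coinWeight`, all `d`, ALL real `q` and ALL real `f, g, h` on `{0,1}^d`):
`E₃^{coin q}(f,g,h) = Σ_{b ∈ {0,…,3}^d} m_b(q) · c_b(f,g,h)`, `m_b(q) = Π_i q_i^{b_i}(1−q_i)^{3−b_i}`, where
`E₃ = 2E(fgh) − E(f)E(gh) − E(g)E(fh) − E(h)E(fg) + E(f)E(g)E(h)` is Sahi's third functional [Sahi2008, p. 213; LiebSahi2021, (2.1)]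
(the tree's `sahiE μ 3`, closed form `sahiE_three`) and `coinWeight q` is the product weight of independent coins
[Sahi2008, eq. (2)].  PROOF: write each of the five terms as a sum over THREE INDEPENDENT COPIES `(x,y,z)` with weight
`w(x)w(y)w(z)` (idle copies carry the constant `1`; `Σ w = 1`), and group the triples by their PROFILE `x+y+z ∈ {0,…,3}^d`: on the
profile class of `b` the weight is the constant `m_b(q)` (`bern3_profile`) and the class sum of the integrand is `c_b` by definition.
This is the census's "three-copy bookkeeping" (CENSUS §175: "E₃(1_A,1_B,1_C)(p) = Σ_b c_b Π p_i^{b_i}(1−p_i)^{3−b_i} for every product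
measure"), now a theorem for arbitrary functions.

CONSEQUENCES.  `sahiE_three_coin_nonneg_of_tc`: Bernstein positivity (`c_b ≥ 0` for all `b`) gives `E₃ ≥ 0` for every `q ∈ [0,1]^d`.
`sahiPositive_coinWeight_of_threeCopySahi`: the obligation `ThreeCopySahi` (3C-SAHI) gives Sahi's `C₃` for every product weight on
every finite cube; `sahiConjecture_three_of_threeCopySahi`: HENCE FOR EVERY FKG PROBABILITY WEIGHT ON EVERY FINITE DISTRIBUTIVE
LATTICE (`SahiConjecture 3`, via Kahn's underlying independents `SahiPositive.of_isFKGMeasure_of_forall_coinWeight`: every FKG weight is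
a monotone image of coins); `kahnConjecture_of_threeCopySahi`: hence Kahn's Conjecture 5.  So the census's finite counting
conjecture (exhaustive for `d ≤ 4`, 1.5·10¹⁰ random pairs at `d = 5,6`, CENSUS §175) is formally AT LEAST AS STRONG AS Sahi's `C₃` in
full generality — an implication between open obligations; NOTHING is asserted about either.  Unconditionally: `tc_ge_neg_harris`
(`c_b ≥ −[N_b(fg;h;1) − N_b(f;g;h)]`) and Harris for coin weights recovered coefficientwise (`sahiE_three_coin_one_nonneg`).
[this work; objects and conjecture: CENSUS §175 W197 (prim-sahi-census gen 54); mechanism folklore (independent copies)]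
-/

namespace Summit.CriticalPhenomena.PercolationContinuityZ3.Theorems.SahiThreeCopy

open Finset Function Literature.Combinatorics.Sahi2008
open scoped BigOperators

noncomputable section

variable {d : ℕ}

/-! ### §1 Bernstein monomials and the profile of a triple -/

/-- The degree-`(3,…,3)` Bernstein monomial `m_b(q) = Π_i q_i^{b_i} (1−q_i)^{3−b_i}` of the profile `b`. [this work] -/
def bern3 (q : Fin d → ℝ) (b : Fin d → ℕ) : ℝ := ∏ i, q i ^ b i * (1 - q i) ^ (3 - b i)

/-- `m_b(q) ≥ 0` for `q ∈ [0,1]^d`. [this work] -/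
theorem bern3_nonneg {q : Fin d → ℝ} (hq : ∀ i, 0 ≤ q i ∧ q i ≤ 1) (b : Fin d → ℕ) : 0 ≤ bern3 q b :=
  prod_nonneg fun i _ => mul_nonneg (pow_nonneg (hq i).1 _) (pow_nonneg (sub_nonneg.2 (hq i).2) _)

/-- The PROFILE `x + y + z ∈ {0,…,3}^d` of a triple of points. [this work] -/
def profile (x y z : Pt d) : Fin d → Fin 4 := fun i =>
  ⟨(x i).toNat + (y i).toNat + (z i).toNat, by
    have h1 := Bool.toNat_le (x i); have h2 := Bool.toNat_le (y i); have h3 := Bool.toNat_le (z i); omega⟩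

/-- A triple is an arrangement of `b ∈ {0,…,3}^d` iff `b` is its profile. [this work] -/
theorem isArr_coe_iff (b : Fin d → Fin 4) (x y z : Pt d) :
    IsArr (fun i => ((b i : Fin 4) : ℕ)) x y z ↔ profile x y z = b := by
  constructor
  · intro h
    funext i
    exact Fin.ext (h i)
  · rintro rfl i
    rfl

/-- The weight of a triple under three independent copies of the coin weight is the Bernstein monomial of its
profile: `w(x)w(y)w(z) = m_{x+y+z}(q)`. [this work] -/
theorem bern3_profile (q : Fin d → ℝ) (x y z : Pt d) :
    bern3 q (fun i => ((profile x y z i : Fin 4) : ℕ)) = coinWeight q x * coinWeight q y * coinWeight q z := by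
  unfold bern3 coinWeight
  rw [← prod_mul_distrib, ← prod_mul_distrib]
  refine prod_congr rfl fun i _ => ?_
  simp only [profile]
  cases x i <;> cases y i <;> cases z i <;>
    simp only [Bool.toNat_true, Bool.toNat_false, Nat.reduceAdd, Nat.reduceSub, if_true, Bool.false_eq_true,
      if_false, pow_zero, pow_one, mul_one, one_mul] <;> ring

/-! ### §2 Grouping three independent copies by their profile -/

/-- For a fixed triple, summing `m_b · F` over the profiles `b` it is an arrangement of picks out `w(x)w(y)w(z)·F`. [this work] -/
theorem sum_profile_ite (q : Fin d → ℝ) (F : ℝ) (x y z : Pt d) :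
    ∑ b : Fin d → Fin 4, (if IsArr (fun i => ((b i : Fin 4) : ℕ)) x y z then bern3 q (fun i => ((b i : Fin 4) : ℕ)) * F
      else 0) = coinWeight q x * coinWeight q y * coinWeight q z * F := by
  simp only [isArr_coe_iff]
  rw [Fintype.sum_ite_eq, bern3_profile]

/-- Reordering a fourfold sum (plumbing). [folklore] -/
theorem sum4_comm (G : Pt d → Pt d → Pt d → (Fin d → Fin 4) → ℝ) :
    ∑ x : Pt d, ∑ y : Pt d, ∑ z : Pt d, ∑ b : Fin d → Fin 4, G x y z b =
      ∑ b : Fin d → Fin 4, ∑ x : Pt d, ∑ y : Pt d, ∑ z : Pt d, G x y z b := by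
  calc (∑ x : Pt d, ∑ y : Pt d, ∑ z : Pt d, ∑ b : Fin d → Fin 4, G x y z b)
      = ∑ x : Pt d, ∑ y : Pt d, ∑ b : Fin d → Fin 4, ∑ z : Pt d, G x y z b :=
        sum_congr rfl fun x _ => sum_congr rfl fun y _ => sum_comm
    _ = ∑ x : Pt d, ∑ b : Fin d → Fin 4, ∑ y : Pt d, ∑ z : Pt d, G x y z b := sum_congr rfl fun x _ => sum_comm
    _ = ∑ b : Fin d → Fin 4, ∑ x : Pt d, ∑ y : Pt d, ∑ z : Pt d, G x y z b := sum_comm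

/-- **Three independent copies, grouped by profile**: for the coin weight `w = coinWeight q`,
`Σ_{x,y,z} w(x)w(y)w(z)·u(x)v(y)r(z) = Σ_{b ∈ {0,…,3}^d} m_b(q) · N_b(u;v;r)`. [this work] -/
theorem sum3_coin_eq (q : Fin d → ℝ) (u v r : Pt d → ℝ) :
    ∑ x, ∑ y, ∑ z, coinWeight q x * coinWeight q y * coinWeight q z * (u x * v y * r z) =
      ∑ b : Fin d → Fin 4, bern3 q (fun i => ((b i : Fin 4) : ℕ)) * N3 (fun i => ((b i : Fin 4) : ℕ)) u v r := by
  have h1 : ∀ x y z : Pt d, coinWeight q x * coinWeight q y * coinWeight q z * (u x * v y * r z) =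
      ∑ b : Fin d → Fin 4, (if IsArr (fun i => ((b i : Fin 4) : ℕ)) x y z then
        bern3 q (fun i => ((b i : Fin 4) : ℕ)) * (u x * v y * r z) else 0) :=
    fun x y z => (sum_profile_ite q (u x * v y * r z) x y z).symm
  simp only [h1]
  unfold N3
  simp only [mul_sum, mul_ite, mul_zero]
  exact sum4_comm _

/-- `E(u)` as a three-copy sum (two idle copies). [this work] -/
theorem ex_coin_eq_sum3 (q : Fin d → ℝ) (u : Pt d → ℝ) :
    ex (coinWeight q) u = ∑ x, ∑ y, ∑ z, coinWeight q x * coinWeight q y * coinWeight q z *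
      (u x * (1 : Pt d → ℝ) y * (1 : Pt d → ℝ) z) := by
  simp only [Pi.one_apply, mul_one]
  rw [ex]
  refine sum_congr rfl fun x _ => ?_
  calc coinWeight q x * u x = coinWeight q x * u x * ((∑ y, coinWeight q y) * (∑ z, coinWeight q z)) := by
        rw [sum_coinWeight, mul_one, mul_one]
    _ = ∑ y, ∑ z, coinWeight q x * coinWeight q y * coinWeight q z * u x := by
        rw [sum_mul_sum, mul_sum]
        refine sum_congr rfl fun y _ => ?_
        rw [mul_sum]
        exact sum_congr rfl fun z _ => by ring

/-- `E(u)E(v)` as a three-copy sum (one idle copy). [this work] -/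
theorem ex_mul_ex_coin_eq_sum3 (q : Fin d → ℝ) (u v : Pt d → ℝ) :
    ex (coinWeight q) u * ex (coinWeight q) v = ∑ x, ∑ y, ∑ z, coinWeight q x * coinWeight q y * coinWeight q z *
      (u x * v y * (1 : Pt d → ℝ) z) := by
  simp only [Pi.one_apply, mul_one]
  rw [ex, ex, sum_mul_sum]
  refine sum_congr rfl fun x _ => sum_congr rfl fun y _ => ?_
  calc coinWeight q x * u x * (coinWeight q y * v y)
      = coinWeight q x * u x * (coinWeight q y * v y) * (∑ z, coinWeight q z) := by rw [sum_coinWeight, mul_one]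
    _ = ∑ z, coinWeight q x * coinWeight q y * coinWeight q z * (u x * v y) := by
        rw [mul_sum]
        exact sum_congr rfl fun z _ => by ring

/-- `E(u)E(v)E(r)` as a three-copy sum. [this work] -/
theorem ex_mul_ex_mul_ex_coin_eq_sum3 (q : Fin d → ℝ) (u v r : Pt d → ℝ) :
    ex (coinWeight q) u * ex (coinWeight q) v * ex (coinWeight q) r =
      ∑ x, ∑ y, ∑ z, coinWeight q x * coinWeight q y * coinWeight q z * (u x * v y * r z) := by
  rw [ex, ex, ex, sum_mul_sum, sum_mul]
  refine sum_congr rfl fun x _ => ?_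
  rw [sum_mul]
  refine sum_congr rfl fun y _ => ?_
  rw [mul_sum]
  exact sum_congr rfl fun z _ => by ring

/-! ### §3 The three-copy (tensor-Bernstein) expansion of Sahi's `E₃` under a coin weight -/

/-- **`E₃^{coin q}(f,g,h) = Σ_{b ∈ {0,…,3}^d} m_b(q) · c_b(f,g,h)`** — Sahi's third functional
[Sahi2008, p. 213; LiebSahi2021, (2.1)] under the product weight of independent coins `q ∈ ℝ^d` on `{0,1}^d`,
for ARBITRARY real `f, g, h`, is the Bernstein combination of the three-copy coefficients `c_b` (the census's
"three-copy bookkeeping", now a theorem: write each of the five terms of `E₃` as an expectation over three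
independent copies and group the triples by their coordinatewise sum). [this work; CENSUS §175 W197] -/
theorem sahiE_three_coinWeight (q : Fin d → ℝ) (f g h : Pt d → ℝ) :
    sahiE (coinWeight q) 3 ![f, g, h] =
      ∑ b : Fin d → Fin 4, bern3 q (fun i => ((b i : Fin 4) : ℕ)) * tc (fun i => ((b i : Fin 4) : ℕ)) f g h := by
  have T1 : ex (coinWeight q) (f * g * h) = ∑ b : Fin d → Fin 4,
      bern3 q (fun i => ((b i : Fin 4) : ℕ)) * N3 (fun i => ((b i : Fin 4) : ℕ)) (f * g * h) 1 1 := by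
    rw [ex_coin_eq_sum3, sum3_coin_eq]
  have T2 : ∀ u v : Pt d → ℝ, ex (coinWeight q) u * ex (coinWeight q) v = ∑ b : Fin d → Fin 4,
      bern3 q (fun i => ((b i : Fin 4) : ℕ)) * N3 (fun i => ((b i : Fin 4) : ℕ)) u v 1 := by
    intro u v
    rw [ex_mul_ex_coin_eq_sum3, sum3_coin_eq]
  have T5 : ex (coinWeight q) f * ex (coinWeight q) g * ex (coinWeight q) h = ∑ b : Fin d → Fin 4,
      bern3 q (fun i => ((b i : Fin 4) : ℕ)) * N3 (fun i => ((b i : Fin 4) : ℕ)) f g h := by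
    rw [ex_mul_ex_mul_ex_coin_eq_sum3, sum3_coin_eq]
  have eR : ∀ b : Fin d → ℕ, bern3 q b * tc b f g h = 2 * (bern3 q b * N3 b (f * g * h) 1 1) + bern3 q b * N3 b f g h -
      (bern3 q b * N3 b f (g * h) 1 + bern3 q b * N3 b g (f * h) 1 + bern3 q b * N3 b h (f * g) 1) := by
    intro b; unfold tc; ring
  simp only [eR, sum_add_distrib, sum_sub_distrib, ← mul_sum]
  rw [sahiE_three, T1, T5, T2 f (g * h), T2 g (f * h), T2 h (f * g)]

/-- **Bernstein positivity ⇒ positivity**: if every three-copy coefficient `c_b(f,g,h)` is nonnegative then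
`E₃^{coin q}(f,g,h) ≥ 0` for every `q ∈ [0,1]^d`. [this work] -/
theorem sahiE_three_coin_nonneg_of_tc {q : Fin d → ℝ} (hq : ∀ i, 0 ≤ q i ∧ q i ≤ 1) {f g h : Pt d → ℝ}
    (htc : ∀ b : Fin d → ℕ, 0 ≤ tc b f g h) : 0 ≤ sahiE (coinWeight q) 3 ![f, g, h] := by
  rw [sahiE_three_coinWeight]
  exact sum_nonneg fun b _ => mul_nonneg (bern3_nonneg hq _) (htc _)

/-! ### §4 3C-SAHI ⇒ Sahi's `C₃` for every FKG poset ⇒ Kahn's Conjecture 5 -/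

/-- **3C-SAHI ⇒ `C₃` for every product measure on every finite cube**: `SahiPositive (coinWeight q) 3` for all `d` and
all `q ∈ [0,1]^d`. [this work] -/
theorem sahiPositive_coinWeight_of_threeCopySahi (H : ThreeCopySahi) (d : ℕ) (q : Fin d → ℝ)
    (hq : ∀ i, 0 ≤ q i ∧ q i ≤ 1) : SahiPositive (coinWeight q) 3 := by
  intro F hF hmono
  have e : F = ![F 0, F 1, F 2] := by
    ext i x; fin_cases i <;> rfl
  rw [e]
  exact sahiE_three_coin_nonneg_of_tc hq fun b =>
    H d b (F 0) (F 1) (F 2) (hF 0) (hF 1) (hF 2) (hmono 0) (hmono 1) (hmono 2)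

/-- **3C-SAHI ⇒ Sahi's Conjecture `C₃` for EVERY FKG poset** (every FKG probability weight on every finite distributive
lattice is a monotone image of independent coins — Kahn's "underlying independents",
`SahiPositive.of_isFKGMeasure_of_forall_coinWeight`).  Written as an implication between two open obligations; nothing is
asserted about either. [this work; Kahn2022, p. 2 footnote 1] -/
theorem sahiConjecture_three_of_threeCopySahi (H : ThreeCopySahi) : SahiConjecture 3 := by
  intro α _ _ μ hμ
  exact SahiPositive.of_isFKGMeasure_of_forall_coinWeight
    (fun m q hq => sahiPositive_coinWeight_of_threeCopySahi H m q fun i => ⟨(hq i).1.le, (hq i).2.le⟩) hμ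

/-- **3C-SAHI ⇒ Kahn's Conjecture 5** (`E₃ ≥ 0` for three increasing events under any product measure on a finite
`Set ι`). [this work; Kahn2022, Conj. 5] -/
theorem kahnConjecture_of_threeCopySahi (H : ThreeCopySahi) : KahnConjecture :=
  sahiConjecture_three_le_kahnConjecture (sahiConjecture_three_of_threeCopySahi H)

/-- `ThreeCopySahi ≤ SahiConjecture 3` (`≤` on `Prop` is `→`), the shape used for the tree's other reductions. [this work] -/
theorem threeCopySahi_le_sahiConjecture_three : ThreeCopySahi ≤ SahiConjecture 3 :=
  fun H => sahiConjecture_three_of_threeCopySahi H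

/-! ### §5 Unconditional consequences at the coefficient level -/

/-- The lower bound `c_b(f,g,h) ≥ −[N_b(fg;h;1) − N_b(f;g;h)]` for nonnegative monotone data (the two nonnegative
three-copy Harris gaps of `tc_eq_harris_sub` dropped). [this work] -/
theorem tc_ge_neg_harris (b : Fin d → ℕ) {f g h : Pt d → ℝ} (hf : ∀ x, 0 ≤ f x) (hfm : Monotone f)
    (hg : ∀ x, 0 ≤ g x) (hgm : Monotone g) (hh : ∀ x, 0 ≤ h x) (hhm : Monotone h) :
    -(N3 b (f * g) h 1 - N3 b f g h) ≤ tc b f g h := by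
  rw [tc_eq_harris_sub]
  have one_nn : ∀ x : Pt d, (0 : ℝ) ≤ (1 : Pt d → ℝ) x := fun _ => zero_le_one
  have h1 := N3_le_N3_mul d b f (g * h) 1 hf hfm (fun x => mul_nonneg (hg x) (hh x)) (hgm.mul hhm hg hh) one_nn
  have h2 := N3_le_N3_mul d b g (f * h) 1 hg hgm (fun x => mul_nonneg (hf x) (hh x)) (hfm.mul hhm hf hh) one_nn
  have e1 : f * (g * h) = f * g * h := by ring
  have e2 : g * (f * h) = f * g * h := by ring
  rw [e1] at h1; rw [e2] at h2
  linarith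

/-- **Harris's inequality for coin weights from three-copy Harris**: `E(fg) ≥ E(f)E(g)`, i.e.
`0 ≤ E₃^{coin q}(f,g,1) = E₂(f,g)`, recovered coefficientwise (`c_b(f,g,1) ≥ 0` for every profile). [this work] -/
theorem sahiE_three_coin_one_nonneg {q : Fin d → ℝ} (hq : ∀ i, 0 ≤ q i ∧ q i ≤ 1) {f g : Pt d → ℝ}
    (hf : ∀ x, 0 ≤ f x) (hfm : Monotone f) (hg : ∀ x, 0 ≤ g x) (hgm : Monotone g) :
    0 ≤ sahiE (coinWeight q) 3 ![f, g, 1] :=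
  sahiE_three_coin_nonneg_of_tc hq fun b => tc_one_right_nonneg b hf hfm hg hgm


/-! ### §6 The percolation rows of crux 4575 from 3C-SAHI (appended, p1 gen53) -/

section Percolation

open Literature.Probability.LatticeModels (prodBernoulli sahiE3)
open Literature.Probability.Percolation

variable {V : Type} [Fintype V]

/-- **3C-SAHI ⇒ the bottom rung `F = SHK3⁺`** of the one-cut programme on every finite weighted graph:
`0 ≤ E₃({a↮b}, {a↮c}, {b↮c})` (through Kahn's Conjecture 5). [this work; CENSUS §175 W197; GladkovZimin2024, Conj. 2.6] -/
theorem sahiE3_pairSep_nonneg_of_threeCopySahi (H : ThreeCopySahi) (w : Sym2 V → unitInterval) (a b c : V) :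
    0 ≤ sahiE3 (prodBernoulli w) (openConn a b)ᶜ (openConn a c)ᶜ (openConn b c)ᶜ :=
  sahiE3_pairSep_nonneg_of_kahnConjecture (kahnConjecture_of_threeCopySahi H) w a b c

/-- **3C-SAHI ⇒ every decreasing E3GRP row** `0 ≤ E₃(D[X₁|Y₁], D[X₂|Y₂], D[X₃|Y₃])` (group separations) on every finite
weighted graph. [this work; CENSUS §175 W197] -/
theorem sahiE3_groupSep_nonneg_of_threeCopySahi (H : ThreeCopySahi) (w : Sym2 V → unitInterval)
    (X₁ Y₁ X₂ Y₂ X₃ Y₃ : Set V) :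
    0 ≤ sahiE3 (prodBernoulli w)
      {ω : BondConfig V | ∀ x ∈ X₁, ∀ y ∈ Y₁, ¬ (openGraph ω).Reachable x y}
      {ω : BondConfig V | ∀ x ∈ X₂, ∀ y ∈ Y₂, ¬ (openGraph ω).Reachable x y}
      {ω : BondConfig V | ∀ x ∈ X₃, ∀ y ∈ Y₃, ¬ (openGraph ω).Reachable x y} :=
  sahiE3_groupSep_nonneg_of_kahnConjecture (kahnConjecture_of_threeCopySahi H) w X₁ Y₁ X₂ Y₂ X₃ Y₃

/-- **3C-SAHI ⇒ every increasing E3GRP row** `0 ≤ E₃(U[X₁|Y₁], U[X₂|Y₂], U[X₃|Y₃])` (group connections; contains ISTAR) on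
every finite weighted graph. [this work; CENSUS §175 W197] -/
theorem sahiE3_groupConn_nonneg_of_threeCopySahi (H : ThreeCopySahi) (w : Sym2 V → unitInterval)
    (X₁ Y₁ X₂ Y₂ X₃ Y₃ : Set V) :
    0 ≤ sahiE3 (prodBernoulli w)
      {ω : BondConfig V | ∃ x ∈ X₁, ∃ y ∈ Y₁, (openGraph ω).Reachable x y}
      {ω : BondConfig V | ∃ x ∈ X₂, ∃ y ∈ Y₂, (openGraph ω).Reachable x y}
      {ω : BondConfig V | ∃ x ∈ X₃, ∃ y ∈ Y₃, (openGraph ω).Reachable x y} :=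
  sahiE3_groupConn_nonneg_of_kahnConjecture (kahnConjecture_of_threeCopySahi H) w X₁ Y₁ X₂ Y₂ X₃ Y₃

end Percolation

end

end Summit.CriticalPhenomena.PercolationContinuityZ3.Theorems.SahiThreeCopy
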